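import Literature.Probability.LatticeModels.SixVertexSpectralFTransform
import Mathlib.Analysis.SpecialFunctions.Pow.Deriv
import Mathlib.Analysis.Complex.CauchyIntegral
import Mathlib.Analysis.Analytic.IsolatedZeros
import Mathlib.Analysis.Complex.Convex

/-!
# Six-vertex spectral measures: the rotation formula for `F` (DKLM 2026, Part II, Lemma 43)

H. Duminil-Copin, K. K. Kozlowski, P. Lammers, I. Manolescu, *Gaussian free field convergence of
the six-vertex model with `-1 ≤ Δ ≤ -1/2`*, arXiv:2603.06268 (2026) [DKLM2026SixVertexGFF]
(`paper:arxiv-2603.06268`, chunk p0027):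

> we shall write `√·` for the unique branch cut `√· : ℂ ∖ ℝ_{≤0} → ℂ₊` which maps positive real
> numbers to positive real numbers.
>
> **Lemma 43.** For any `(x,y) ∈ ℂ₊ × ℝ`, we have `F(x,y) = x/√(x²+y²) · F(√(x²+y²), 0)`.
>
> *Proof.* If `x` is real, then this follows from Equation (eq:F_as_derivative_of_I) in Lemma 38.
> For fixed `y`, both sides in Equation (eq:rotation_of_F) are holomorphic functions in `x ∈ ℂ₊`,
> thanks to Lemma 37 (iii). Since they coincide on the positive real axis, they must be equal for
> all `x ∈ ℂ₊`.

This file proves Lemma 43 **conditionally on its real-axis case** (the consequence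
`F(x,y) = x/√(x²+y²) F(√(x²+y²),0)`, `x > 0`, of eq. (eq:F_as_derivative_of_I) of Lemma 38, which
rests on the rotational invariance of Theorem 4): for `μ ∈ 𝓜_{c,C}`, holomorphy of `F(·,y)`
(`differentiableOn_dklmF`, Lemma 37 (iii)) and of the right-hand side on `ℂ₊`, and the identity
theorem (`AnalyticOnNhd.eqOn_of_preconnected_of_frequently_eq`).

* `csqrt` — the principal branch `z ↦ z^{1/2}` (`ℂ ∖ ℝ_{≤0} → ℂ₊`, `csqrt_re_pos`, `csqrt_ofReal`);
* **`dklmF_rotation` — Lemma 43.**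

## References

* H. Duminil-Copin, K. K. Kozlowski, P. Lammers, I. Manolescu, arXiv:2603.06268 (2026), Part II,
  Lemma 43 (with Lemma 37 (iii), Lemma 38). [DKLM2026SixVertexGFF]
-/

noncomputable section

open MeasureTheory Set Filter Topology Complex

namespace Literature.Probability.LatticeModels.SixVertex

/-! ## 1. The principal square root -/

/-- The principal branch `√z = z^{1/2} = exp(½ Log z)` (`ℂ ∖ ℝ_{≤0} → ℂ₊`, positive on positive reals).
[cite: DKLM2026SixVertexGFF, Part II §1.4, eq. (branch cut)] -/
def csqrt (z : ℂ) : ℂ := z ^ (1 / 2 : ℂ)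

/-- `√z` has positive real part off the branch cut. [cite: DKLM2026SixVertexGFF, Part II §1.4] -/
theorem csqrt_re_pos {z : ℂ} (hz : z ∈ slitPlane) : 0 < (csqrt z).re := by
  obtain ⟨harg, hz0⟩ := mem_slitPlane_iff_arg.1 hz
  rw [csqrt, cpow_def_of_ne_zero hz0, Complex.exp_re]
  refine mul_pos (Real.exp_pos _) (Real.cos_pos_of_mem_Ioo ⟨?_, ?_⟩)
  · have him : (Complex.log z * (1 / 2 : ℂ)).im = z.arg / 2 := by
      rw [show (1 / 2 : ℂ) = ((1 / 2 : ℝ) : ℂ) by push_cast; ring, Complex.mul_im, Complex.ofReal_re,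
        Complex.ofReal_im, Complex.log_im]
      ring
    rw [him]
    linarith [Complex.neg_pi_lt_arg z]
  · have him : (Complex.log z * (1 / 2 : ℂ)).im = z.arg / 2 := by
      rw [show (1 / 2 : ℂ) = ((1 / 2 : ℝ) : ℂ) by push_cast; ring, Complex.mul_im, Complex.ofReal_re,
        Complex.ofReal_im, Complex.log_im]
      ring
    rw [him]
    have := lt_of_le_of_ne (Complex.arg_le_pi z) harg
    linarith

/-- `√z ≠ 0` off the branch cut. [folklore] -/
theorem csqrt_ne_zero {z : ℂ} (hz : z ∈ slitPlane) : csqrt z ≠ 0 := fun h => by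
  have := csqrt_re_pos hz
  rw [h, Complex.zero_re] at this
  exact lt_irrefl _ this

/-- `√r` is the real square root for `r ≥ 0`. [folklore] -/
theorem csqrt_ofReal {r : ℝ} (hr : 0 ≤ r) : csqrt r = (Real.sqrt r : ℂ) := by
  rw [csqrt, Real.sqrt_eq_rpow, Complex.ofReal_cpow hr]
  norm_num

/-- `√·` is holomorphic off the branch cut. [folklore] -/
theorem differentiableAt_csqrt {z : ℂ} (hz : z ∈ slitPlane) : DifferentiableAt ℂ csqrt z := by
  unfold csqrt
  exact differentiableAt_id.cpow_const hz

/-- For `Re x > 0` and real `y`, `x² + y²` is off the branch cut. [cite: DKLM2026SixVertexGFF, Part II, Lemma 43] -/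
theorem sq_add_sq_mem_slitPlane {x : ℂ} (hx : 0 < x.re) (y : ℝ) : x ^ 2 + (y : ℂ) ^ 2 ∈ slitPlane := by
  rw [mem_slitPlane_iff]
  by_cases him : x.im = 0
  · left
    have : (x ^ 2 + (y : ℂ) ^ 2).re = x.re ^ 2 - x.im ^ 2 + y ^ 2 := by
      simp [sq, Complex.add_re, Complex.mul_re]
    rw [this, him]
    nlinarith
  · right
    have : (x ^ 2 + (y : ℂ) ^ 2).im = 2 * x.re * x.im := by
      simp [sq, Complex.add_im, Complex.mul_im]; ring
    rw [this]
    exact mul_ne_zero (mul_ne_zero two_ne_zero hx.ne') him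

/-! ## 2. Lemma 43 -/

section Rotation

variable {c C : ℝ} {μ : Measure (ℝ × ℝ)}

/-- **Lemma 43 (rotation formula for `F`)**, conditionally on its real-axis case
(eq. (eq:F_as_derivative_of_I) of Lemma 38): for `μ ∈ 𝓜_{c,C}`, if
`F(x,y) = x/√(x²+y²) F(√(x²+y²),0)` for all real `x > 0`, then the same holds for all `x ∈ ℂ₊`
with the principal branch of the square root (holomorphy of both sides in `x`, Lemma 37 (iii),
and the identity theorem). [cite: DKLM2026SixVertexGFF, Part II, Lemma 43] -/
theorem dklmF_rotation (h : μ ∈ dklmSpaceM c C) (y : ℝ)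
    (hreal : ∀ x : ℝ, 0 < x →
      dklmF μ x y = ((x / Real.sqrt (x ^ 2 + y ^ 2) : ℝ) : ℂ) * dklmF μ (Real.sqrt (x ^ 2 + y ^ 2) : ℝ) 0)
    {x : ℂ} (hx : 0 < x.re) :
    dklmF μ x y = x / csqrt (x ^ 2 + y ^ 2) * dklmF μ (csqrt (x ^ 2 + y ^ 2)) 0 := by
  set U : Set ℂ := {x : ℂ | 0 < x.re} with hUdef
  have hU : IsOpen U := isOpen_lt continuous_const Complex.continuous_re
  have hUconn : IsPreconnected U := (convex_halfSpace_re_gt 0).isPreconnected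
  -- both sides are holomorphic on `ℂ₊`
  have hf : AnalyticOnNhd ℂ (fun x => dklmF μ x y) U := (differentiableOn_dklmF h y).analyticOnNhd hU
  have hg : AnalyticOnNhd ℂ (fun x : ℂ => x / csqrt (x ^ 2 + y ^ 2) * dklmF μ (csqrt (x ^ 2 + y ^ 2)) 0) U := by
    refine DifferentiableOn.analyticOnNhd (fun x (hx : 0 < x.re) => ?_) hU
    have hs : x ^ 2 + (y : ℂ) ^ 2 ∈ slitPlane := sq_add_sq_mem_slitPlane hx y
    have hw : DifferentiableAt ℂ (fun x : ℂ => csqrt (x ^ 2 + y ^ 2)) x :=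
      DifferentiableAt.comp (g := csqrt) (f := fun x : ℂ => x ^ 2 + (y : ℂ) ^ 2) x (differentiableAt_csqrt hs)
        (by fun_prop)
    have hwU : csqrt (x ^ 2 + y ^ 2) ∈ U := csqrt_re_pos hs
    have hF : DifferentiableAt ℂ (fun w => dklmF μ w 0) (csqrt (x ^ 2 + y ^ 2)) :=
      (differentiableOn_dklmF h 0).differentiableAt (hU.mem_nhds hwU)
    exact ((differentiableAt_id.div hw (csqrt_ne_zero hs)).mul (hF.comp x hw)).differentiableWithinAt
  -- they agree on the positive real axis, which accumulates at `1`
  have ht : Tendsto (fun n : ℕ => (((1 + 1 / ((n : ℝ) + 1) : ℝ)) : ℂ)) atTop (𝓝[≠] (1 : ℂ)) := by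
    rw [tendsto_nhdsWithin_iff]
    constructor
    · have h1 : Tendsto (fun n : ℕ => (1 + 1 / ((n : ℝ) + 1) : ℝ)) atTop (𝓝 1) := by
        have := (tendsto_one_div_add_atTop_nhds_zero_nat).const_add (1 : ℝ)
        rwa [add_zero] at this
      have h2 := (Complex.continuous_ofReal.tendsto (1 : ℝ)).comp h1
      rw [Complex.ofReal_one] at h2
      exact h2
    · refine Eventually.of_forall fun n => ?_
      rw [mem_compl_iff, mem_singleton_iff, ← Complex.ofReal_one, Complex.ofReal_inj]
      have : (0 : ℝ) < 1 / ((n : ℝ) + 1) := by positivity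
      linarith
  have hfreq : ∃ᶠ z in 𝓝[≠] (1 : ℂ), (fun x => dklmF μ x y) z =
      (fun x : ℂ => x / csqrt (x ^ 2 + y ^ 2) * dklmF μ (csqrt (x ^ 2 + y ^ 2)) 0) z := by
    refine ht.frequently (Frequently.of_forall fun n => ?_)
    have hpos : (0 : ℝ) < 1 + 1 / ((n : ℝ) + 1) := by positivity
    set r : ℝ := 1 + 1 / ((n : ℝ) + 1) with hr
    simp only
    rw [hreal r hpos, show (r : ℂ) ^ 2 + (y : ℂ) ^ 2 = ((r ^ 2 + y ^ 2 : ℝ) : ℂ) by push_cast; ring,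
      csqrt_ofReal (by positivity)]
    push_cast
    ring
  exact hf.eqOn_of_preconnected_of_frequently_eq hg hUconn (show (1 : ℂ) ∈ U by simp [hUdef]) hfreq hx

end Rotation

end Literature.Probability.LatticeModels.SixVertex

end
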